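import Summits.QuantumFields.YangMills.Theorems.WeakCouplingRatesBoxDecay

/-!
# Route `WeakCouplingRates`, crux `ColdBoxTwoPointFloorW`, stub S4 `stub_boxKernelVsLattice`: the ramp cut-off and the
# `O(H⁻⁴)` comparison of the box kernel with the `ℤ⁴` curl kernel

Helper file 4/5 (fleet seat `ym-wcr-19608-p2`, item stmt-QuantumFields-19608, line `birth`, skeleton v5).  Inputs: the decay bounds of
`Theorems/WeakCouplingRatesBoxDecay.lean` and the comparison theorem `abs_boxProjKernel_sub_curl_le` of
`Theorems/WeakCouplingRatesBoxHodge.lean`.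

* the ramp `boxCutoff H`: values in `[0,1]`, `= 1` on the sup-ball of radius `H/2 − 1`, `= 0` near the boundary,
  `(2/H)`-Lipschitz, supported in the inner box; the Leibniz formula `div₃_one_sub_smul` and the size
  `abs_div₃_cutoff_le` (`O(H⁻⁴)` pointwise off the plateau, zero on it) of the cut-off co-potential;
* `exists_boxProjKernel_sub_curl_bound` — **for `H ≥ 32` and plaquettes `p, q` of the box based within `H/8` of the centre,
  `|boxProjKernel H p q − (d₁ div₂ g_q)(p)| ≤ K/H⁴`**.

No sorry, standard axioms; no new definition.  NOT a claim about the mass gap.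
-/

set_option autoImplicit false

noncomputable section

open Finset
open Literature.Probability.LatticeModels
open Literature.MathematicalPhysics.QuantumLattice
open Literature.MathematicalPhysics.QuantumFieldTheory
open Literature.MathematicalPhysics.QuantumFieldTheory.LatticeChain
open Literature.MathematicalPhysics.QuantumFieldTheory.LatticeForm (e d₁ d₂)

namespace Summit.QuantumFields.YangMills.Theorems.WeakCouplingRates

/-! ## The ramp cut-off `boxCutoff H` -/

section Cutoff

variable {H : ℕ}

/-- `0 ≤ χ ≤ 1`. -/
theorem boxCutoff_mem_Icc (H : ℕ) (y : Site 4) : 0 ≤ boxCutoff H y ∧ boxCutoff H y ≤ 1 :=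
  ⟨le_min zero_le_one (le_max_left _ _), min_le_left _ _⟩

/-- `χ = 1` on the sup-ball of radius `H/2 − 1` about the centre. -/
theorem boxCutoff_eq_one (hH : 0 < H) {y : Site 4} (hy : ‖y - boxCentre H‖ ≤ (H : ℝ) / 2 - 1) :
    boxCutoff H y = 1 := by
  have hH' : (0 : ℝ) < H := by exact_mod_cast hH
  have h1 : (1 : ℝ) ≤ 2 * ((H : ℝ) - 1 - ‖y - boxCentre H‖) / H := by
    rw [le_div_iff₀ hH']; linarith
  unfold boxCutoff
  rw [min_eq_left_iff]
  exact h1.trans (le_max_right _ _)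

/-- `χ = 0` within sup-distance `1` of the complement of the box. -/
theorem boxCutoff_eq_zero (hH : 0 < H) {y : Site 4} (hy : (H : ℝ) - 1 ≤ ‖y - boxCentre H‖) :
    boxCutoff H y = 0 := by
  have hH' : (0 : ℝ) < H := by exact_mod_cast hH
  have h1 : 2 * ((H : ℝ) - 1 - ‖y - boxCentre H‖) / H ≤ 0 :=
    div_nonpos_of_nonpos_of_nonneg (by linarith) hH'.le
  unfold boxCutoff
  rw [max_eq_left h1, min_eq_right zero_le_one]

/-- `χ` is `(2/H)`-Lipschitz for the sup norm. -/
theorem abs_boxCutoff_sub_le (hH : 0 < H) (y y' : Site 4) :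
    |boxCutoff H y - boxCutoff H y'| ≤ 2 / H * ‖y - y'‖ := by
  have hH' : (0 : ℝ) < H := by exact_mod_cast hH
  unfold boxCutoff
  set a := 2 * ((H : ℝ) - 1 - ‖y - boxCentre H‖) / H with ha
  set b := 2 * ((H : ℝ) - 1 - ‖y' - boxCentre H‖) / H with hb
  have h1 : |min 1 (max 0 a) - min 1 (max 0 b)| ≤ |max 0 a - max 0 b| := by
    have := abs_min_sub_min_le_max (1 : ℝ) (max 0 a) 1 (max 0 b)
    simpa using this
  have h2 : |max 0 a - max 0 b| ≤ |a - b| := by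
    have := abs_max_sub_max_le_max (0 : ℝ) a 0 b
    simpa using this
  have h3 : |a - b| ≤ 2 / H * ‖y - y'‖ := by
    have hab : a - b = 2 / H * (‖y' - boxCentre H‖ - ‖y - boxCentre H‖) := by rw [ha, hb]; ring
    rw [hab, abs_mul, abs_of_pos (by positivity : (0 : ℝ) < 2 / H)]
    refine mul_le_mul_of_nonneg_left ?_ (by positivity)
    have := abs_norm_sub_norm_le (y' - boxCentre H) (y - boxCentre H)
    rw [show y' - boxCentre H - (y - boxCentre H) = y' - y by abel, ← norm_neg (y' - y),
      show -(y' - y) = y - y' by abel] at this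
    exact this
  exact h1.trans (h2.trans h3)

/-- The support of `χ` lies in the inner box `{0,…,2H−1}⁴`. -/
theorem mem_halfOpenBox_of_boxCutoff_ne_zero (y : Site 4) (hy : boxCutoff H y ≠ 0) :
    y ∈ halfOpenBox 4 (2 * H + 1 - 1) := by
  rw [Nat.add_sub_cancel, mem_halfOpenBox]
  have hH : 0 < H := by
    rcases Nat.eq_zero_or_pos H with h | h
    · exfalso; apply hy; subst h; simp [boxCutoff]
    · exact h
  have hr : ‖y - boxCentre H‖ < (H : ℝ) - 1 := by
    by_contra hcon
    exact hy (boxCutoff_eq_zero hH (not_lt.1 hcon))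
  intro m
  have hm : |((y m : ℤ) : ℝ) - H| < (H : ℝ) - 1 := by
    have := abs_coord_le_norm (y - boxCentre H) m
    simp only [Pi.sub_apply, boxCentre, Int.cast_sub, Int.cast_natCast] at this
    linarith
  rw [abs_lt] at hm
  obtain ⟨h1, h2⟩ := hm
  have h1' : (1 : ℝ) < (y m : ℝ) := by linarith
  have h2' : ((y m : ℤ) : ℝ) < 2 * (H : ℝ) - 1 := by linarith
  constructor
  · exact_mod_cast (zero_lt_one.trans h1').le
  · have : ((y m : ℤ) : ℝ) < ((2 * H : ℕ) : ℤ) := by push_cast; linarith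
    exact_mod_cast this

/-- Two steps inside the plateau: `χ(y) = 1` and `χ(y − eₘ) = 1` when `‖y − centre‖ ≤ H/2 − 2`. -/
theorem boxCutoff_eq_one_near (hH : 0 < H) {y : Site 4} (hy : ‖y - boxCentre H‖ ≤ (H : ℝ) / 2 - 2) (m : Fin 4) :
    boxCutoff H y = 1 ∧ boxCutoff H (y - e m) = 1 := by
  refine ⟨boxCutoff_eq_one hH (by linarith), boxCutoff_eq_one hH ?_⟩
  have : ‖y - e m - boxCentre H‖ ≤ ‖y - boxCentre H‖ + 1 := by
    have h := norm_sub_le (y - boxCentre H) (e m)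
    rw [norm_e, show y - boxCentre H - e m = y - e m - boxCentre H by abel] at h
    exact h
  linarith

end Cutoff

/-! ## The cut-off co-potential `V_q = div₃ ((1−χ)·d₂ g_q)`: identity, support, size -/

/-- **Leibniz formula for the cut-off divergence**:
`div₃((1−χ)W)(y;k,l) = (1 − χ(y))·(div₃ W)(y;k,l) + Σₘ (χ(y) − χ(y−eₘ))·W(y−eₘ; m,k,l)`. -/
theorem div₃_one_sub_smul (χ : Site 4 → ℝ) (W : Site 4 → Fin 4 → Fin 4 → Fin 4 → ℝ) (y : Site 4) (k l : Fin 4) :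
    div₃ (fun y a b c => (1 - χ y) * W y a b c) y k l =
      (1 - χ y) * div₃ W y k l + ∑ m : Fin 4, (χ y - χ (y - e m)) * W (y - e m) m k l := by
  simp only [div₃, Finset.mul_sum, ← Finset.sum_add_distrib]
  exact Finset.sum_congr rfl fun m _ => by ring

/-- The cut-off co-potential vanishes on the plateau `‖y − centre‖ ≤ H/2 − 2`. -/
theorem div₃_cutoff_eq_zero {H : ℕ} (hH : 0 < H) (W : Site 4 → Fin 4 → Fin 4 → Fin 4 → ℝ) {y : Site 4}
    (hy : ‖y - boxCentre H‖ ≤ (H : ℝ) / 2 - 2) (k l : Fin 4) :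
    div₃ (fun y a b c => (1 - boxCutoff H y) * W y a b c) y k l = 0 := by
  rw [div₃_one_sub_smul]
  have h1 : boxCutoff H y = 1 := (boxCutoff_eq_one_near hH hy k).1
  have h2 : ∀ m : Fin 4, boxCutoff H (y - e m) = 1 := fun m => (boxCutoff_eq_one_near hH hy m).2
  simp [h1, h2]

/-- Distance bookkeeping off the plateau: if `‖y − c‖ > H/2 − 2`, `‖x − c‖ ≤ H/8` and `H ≥ 32` then `‖y − x‖ ≥ H/4 + 2`. -/
theorem dist_off_plateau {H : ℕ} (hH : (32 : ℝ) ≤ H) {y x : Site 4} (hy : (H : ℝ) / 2 - 2 < ‖y - boxCentre H‖)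
    (hx : ‖x - boxCentre H‖ ≤ (H : ℝ) / 8) : (H : ℝ) / 4 + 2 ≤ ‖y - x‖ := by
  have h := norm_sub_norm_le (y - boxCentre H) (x - boxCentre H)
  rw [show y - boxCentre H - (x - boxCentre H) = y - x by abel] at h
  linarith

/-- Elementary: for `0 < a ≤ r`, `K ≥ 0`: `K/r^n ≤ K/a^n`. -/
theorem div_pow_le_div_pow {K a r : ℝ} (hK : 0 ≤ K) (ha : 0 < a) (har : a ≤ r) (n : ℕ) :
    K / r ^ n ≤ K / a ^ n :=
  div_le_div_of_nonneg_left hK (pow_pos ha n) (pow_le_pow_left₀ ha.le har n)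

/-- **Size of the cut-off co-potential off the plateau**: with the decay constants `K_Z` (curl kernel) and `K_W`
(co-potential), for `H ≥ 32`, `‖x_q − c‖ ≤ H/8` and `‖y − c‖ > H/2 − 2`:
`|V_q(y;k,l)| ≤ (256 K_Z + 512 K_W)/H⁴`. -/
theorem abs_div₃_cutoff_le {K_Z K_W : ℝ} (hKZ0 : 0 ≤ K_Z) (hKW0 : 0 ≤ K_W)
    (hKZ : ∀ (q : Plaq 4) (y : Site 4) (k l : Fin 4), 3 ≤ ‖y - q.1‖ →
      |d₁ (div₂ (greenTensor q)) y k l| ≤ K_Z / ‖y - q.1‖ ^ 4)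
    (hKW : ∀ (q : Plaq 4) (y : Site 4) (a b c : Fin 4), y ≠ q.1 → |d₂ (greenTensor q) y a b c| ≤ K_W / ‖y - q.1‖ ^ 3)
    {H : ℕ} (hH : (32 : ℝ) ≤ H) {q : Plaq 4} (hq : ‖q.1 - boxCentre H‖ ≤ (H : ℝ) / 8) {y : Site 4}
    (hy : (H : ℝ) / 2 - 2 < ‖y - boxCentre H‖) (k l : Fin 4) :
    |div₃ (fun y a b c => (1 - boxCutoff H y) * d₂ (greenTensor q) y a b c) y k l| ≤ (256 * K_Z + 512 * K_W) / H ^ 4 := by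
  have hH0 : (0 : ℝ) < H := by linarith
  have hHn : 0 < H := by exact_mod_cast hH0
  have hr := dist_off_plateau hH hy hq
  have hr3 : 3 ≤ ‖y - q.1‖ := by linarith
  rw [div₃_one_sub_smul]
  -- the `U`-term
  have hU : |(1 - boxCutoff H y) * div₃ (d₂ (greenTensor q)) y k l| ≤ 256 * K_Z / H ^ 4 := by
    have hyq : y ≠ q.1 := by
      intro h; rw [h, sub_self, norm_zero] at hr3; linarith
    rw [div₃_d₂_greenTensor_of_ne q hyq, abs_mul, abs_neg]
    have h1 : |1 - boxCutoff H y| ≤ 1 := by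
      obtain ⟨h0, h1⟩ := boxCutoff_mem_Icc H y
      rw [abs_le]; constructor <;> linarith
    have h2 := hKZ q y k l hr3
    have h3 : K_Z / ‖y - q.1‖ ^ 4 ≤ K_Z / ((H : ℝ) / 4) ^ 4 := div_pow_le_div_pow hKZ0 (by positivity) (by linarith) 4
    have h4 : K_Z / ((H : ℝ) / 4) ^ 4 = 256 * K_Z / H ^ 4 := by field_simp; ring
    calc |1 - boxCutoff H y| * |d₁ (div₂ (greenTensor q)) y k l| ≤ 1 * |d₁ (div₂ (greenTensor q)) y k l| :=
          mul_le_mul_of_nonneg_right h1 (abs_nonneg _)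
      _ ≤ 256 * K_Z / H ^ 4 := by linarith
  -- the `W`-terms
  have hW : ∀ m : Fin 4, |(boxCutoff H y - boxCutoff H (y - e m)) * d₂ (greenTensor q) (y - e m) m k l| ≤
      128 * K_W / H ^ 4 := by
    intro m
    rw [abs_mul]
    have h1 : |boxCutoff H y - boxCutoff H (y - e m)| ≤ 2 / H := by
      have := abs_boxCutoff_sub_le hHn y (y - e m)
      rwa [show y - (y - e m) = e m by abel, norm_e, mul_one] at this
    have hd : (H : ℝ) / 4 ≤ ‖y - e m - q.1‖ := by
      have := norm_sub_norm_le (y - q.1) (e m)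
      rw [norm_e, show y - q.1 - e m = y - e m - q.1 by abel] at this
      linarith
    have hne : y - e m ≠ q.1 := by
      intro h; rw [h, sub_self, norm_zero] at hd; linarith
    have h2 := hKW q (y - e m) m k l hne
    have h3 : K_W / ‖y - e m - q.1‖ ^ 3 ≤ K_W / ((H : ℝ) / 4) ^ 3 := div_pow_le_div_pow hKW0 (by positivity) hd 3
    have h4 : 2 / (H : ℝ) * (K_W / ((H : ℝ) / 4) ^ 3) = 128 * K_W / H ^ 4 := by field_simp; ring
    calc |boxCutoff H y - boxCutoff H (y - e m)| * |d₂ (greenTensor q) (y - e m) m k l|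
        ≤ 2 / H * (K_W / ((H : ℝ) / 4) ^ 3) :=
          mul_le_mul h1 (h2.trans h3) (abs_nonneg _) (by positivity)
      _ = 128 * K_W / H ^ 4 := h4
  have hsum : |∑ m : Fin 4, (boxCutoff H y - boxCutoff H (y - e m)) * d₂ (greenTensor q) (y - e m) m k l| ≤
      512 * K_W / H ^ 4 := by
    refine (Finset.abs_sum_le_sum_abs _ _).trans ?_
    calc ∑ m : Fin 4, |(boxCutoff H y - boxCutoff H (y - e m)) * d₂ (greenTensor q) (y - e m) m k l|
        ≤ ∑ _m : Fin 4, 128 * K_W / (H : ℝ) ^ 4 := Finset.sum_le_sum fun m _ => hW m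
      _ = 512 * K_W / H ^ 4 := by
          rw [Finset.sum_const, Finset.card_univ, Fintype.card_fin, nsmul_eq_mul]; push_cast; ring
  calc |(1 - boxCutoff H y) * div₃ (d₂ (greenTensor q)) y k l +
        ∑ m : Fin 4, (boxCutoff H y - boxCutoff H (y - e m)) * d₂ (greenTensor q) (y - e m) m k l|
      ≤ |(1 - boxCutoff H y) * div₃ (d₂ (greenTensor q)) y k l| +
        |∑ m : Fin 4, (boxCutoff H y - boxCutoff H (y - e m)) * d₂ (greenTensor q) (y - e m) m k l| := abs_add_le _ _
    _ ≤ 256 * K_Z / H ^ 4 + 512 * K_W / H ^ 4 := add_le_add hU hsum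
    _ = (256 * K_Z + 512 * K_W) / H ^ 4 := by ring

/-! ## The box kernel versus the `ℤ⁴` curl kernel: the `O(H⁻⁴)` error bound -/

/-- The number of plaquettes of the box `{0,…,2H}⁴` is at most `1296 H⁴` (`H ≥ 1`). -/
theorem card_boxPlaquettes_le {H : ℕ} (hH : 1 ≤ H) :
    (#(plaquettesIn (halfOpenBox 4 (2 * H + 1))) : ℝ) ≤ 1296 * (H : ℝ) ^ 4 := by
  have h1 : (#(plaquettesIn (halfOpenBox 4 (2 * H + 1))) : ℝ) ≤ 4 * 4 * ((2 * H + 1 : ℕ) : ℝ) ^ 4 := by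
    exact_mod_cast AxialGauge.card_plaquettesIn_le (d := 4) (2 * H + 1)
  have h2 : ((2 * H + 1 : ℕ) : ℝ) ≤ 3 * H := by
    have : (1 : ℝ) ≤ H := by exact_mod_cast hH
    push_cast; linarith
  have h3 : ((2 * H + 1 : ℕ) : ℝ) ^ 4 ≤ (3 * (H : ℝ)) ^ 4 := pow_le_pow_left₀ (by positivity) h2 4
  nlinarith

/-- **The box kernel is the `ℤ⁴` curl kernel up to `O(H⁻⁴)`** (S4 core estimate).  There is `K` such that for every
`H ≥ 32` and all plaquettes `p, q` of the box `{0,…,2H}⁴` based within sup-distance `H/8` of the centre,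
`|boxProjKernel H p q − (d₁ div₂ g_q)(p)| ≤ K/H⁴`. -/
theorem exists_boxProjKernel_sub_curl_bound : ∃ K : ℝ, 0 ≤ K ∧ ∀ (H : ℕ), (32 : ℝ) ≤ H →
    ∀ (p q : Plaq 4), p ∈ plaquettesIn (halfOpenBox 4 (2 * H + 1)) → q ∈ plaquettesIn (halfOpenBox 4 (2 * H + 1)) →
      ‖p.1 - boxCentre H‖ ≤ (H : ℝ) / 8 → ‖q.1 - boxCentre H‖ ≤ (H : ℝ) / 8 →
      |boxProjKernel H p q - d₁ (div₂ (greenTensor q)) p.1 p.2.1 p.2.2| ≤ K / (H : ℝ) ^ 4 := by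
  obtain ⟨K_Z, hKZ0, hKZ⟩ := exists_curl_greenTensor_bound
  obtain ⟨K_W, hKW0, hKW⟩ := exists_d₂_greenTensor_bound
  set K_V : ℝ := 256 * K_Z + 512 * K_W with hKV
  have hKV0 : 0 ≤ K_V := by positivity
  refine ⟨1296 * (256 * K_Z * K_V + K_V ^ 2), by positivity, fun H hH p q hp hq hpc hqc => ?_⟩
  have hH0 : (0 : ℝ) < H := by linarith
  have hHn : 0 < H := by exact_mod_cast hH0
  have hH1 : 1 ≤ H := hHn
  set P := plaquettesIn (halfOpenBox 4 (2 * H + 1)) with hP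
  -- the comparison theorem with the ramp cut-off
  have hmain := abs_boxProjKernel_sub_curl_le H hp hq (χ := boxCutoff H) (fun y hy => mem_halfOpenBox_of_boxCutoff_ne_zero y hy)
  -- pointwise bounds on the plaquettes of the box
  have hV : ∀ (x : Plaq 4), ‖x.1 - boxCentre H‖ ≤ (H : ℝ) / 8 → ∀ p' : Plaq 4,
      |div₃ (fun y a b c => (1 - boxCutoff H y) * d₂ (greenTensor x) y a b c) p'.1 p'.2.1 p'.2.2| ≤ K_V / (H : ℝ) ^ 4 := by
    intro x hx p'
    by_cases hfar : (H : ℝ) / 2 - 2 < ‖p'.1 - boxCentre H‖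
    · exact abs_div₃_cutoff_le hKZ0 hKW0 hKZ hKW hH hx hfar _ _
    · rw [div₃_cutoff_eq_zero hHn _ (not_lt.1 hfar), abs_zero]; positivity
  have hZV : ∀ p' ∈ P, |d₁ (div₂ (greenTensor p)) p'.1 p'.2.1 p'.2.2| *
      |div₃ (fun y a b c => (1 - boxCutoff H y) * d₂ (greenTensor q) y a b c) p'.1 p'.2.1 p'.2.2| ≤
      (256 * K_Z / (H : ℝ) ^ 4) * (K_V / (H : ℝ) ^ 4) := by
    intro p' _
    by_cases hfar : (H : ℝ) / 2 - 2 < ‖p'.1 - boxCentre H‖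
    · have hr := dist_off_plateau hH hfar hpc
      have hZ := hKZ p p'.1 p'.2.1 p'.2.2 (by linarith)
      have hZ' : |d₁ (div₂ (greenTensor p)) p'.1 p'.2.1 p'.2.2| ≤ 256 * K_Z / (H : ℝ) ^ 4 := by
        have h3 : K_Z / ‖p'.1 - p.1‖ ^ 4 ≤ K_Z / ((H : ℝ) / 4) ^ 4 :=
          div_pow_le_div_pow hKZ0 (by positivity) (by linarith) 4
        have h4 : K_Z / ((H : ℝ) / 4) ^ 4 = 256 * K_Z / H ^ 4 := by field_simp; ring
        linarith
      exact mul_le_mul hZ' (hV q hqc p') (abs_nonneg _) (by positivity)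
    · rw [div₃_cutoff_eq_zero hHn _ (not_lt.1 hfar), abs_zero, mul_zero]; positivity
  have hcard := card_boxPlaquettes_le hH1
  -- the first error term
  have hsum1 : ∑ p' ∈ P, |d₁ (div₂ (greenTensor p)) p'.1 p'.2.1 p'.2.2| *
      |div₃ (fun y a b c => (1 - boxCutoff H y) * d₂ (greenTensor q) y a b c) p'.1 p'.2.1 p'.2.2| ≤
      1296 * (H : ℝ) ^ 4 * ((256 * K_Z / (H : ℝ) ^ 4) * (K_V / (H : ℝ) ^ 4)) := by
    refine (Finset.sum_le_card_nsmul _ _ _ hZV).trans ?_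
    rw [nsmul_eq_mul]
    exact mul_le_mul_of_nonneg_right hcard (by positivity)
  -- the second error term
  have hsq : ∀ (x : Plaq 4), ‖x.1 - boxCentre H‖ ≤ (H : ℝ) / 8 →
      ∑ p' ∈ P, div₃ (fun y a b c => (1 - boxCutoff H y) * d₂ (greenTensor x) y a b c) p'.1 p'.2.1 p'.2.2 ^ 2 ≤
        1296 * (H : ℝ) ^ 4 * (K_V / (H : ℝ) ^ 4) ^ 2 := by
    intro x hx
    have hterm : ∀ p' ∈ P,
        div₃ (fun y a b c => (1 - boxCutoff H y) * d₂ (greenTensor x) y a b c) p'.1 p'.2.1 p'.2.2 ^ 2 ≤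
          (K_V / (H : ℝ) ^ 4) ^ 2 := by
      intro p' _
      have h := hV x hx p'
      rw [← sq_abs]
      exact pow_le_pow_left₀ (abs_nonneg _) h 2
    refine (Finset.sum_le_card_nsmul _ _ _ hterm).trans ?_
    rw [nsmul_eq_mul]
    exact mul_le_mul_of_nonneg_right hcard (by positivity)
  have hsum2 : Real.sqrt (∑ p' ∈ P, div₃ (fun y a b c => (1 - boxCutoff H y) * d₂ (greenTensor p) y a b c)
        p'.1 p'.2.1 p'.2.2 ^ 2) *
      Real.sqrt (∑ p' ∈ P, div₃ (fun y a b c => (1 - boxCutoff H y) * d₂ (greenTensor q) y a b c)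
        p'.1 p'.2.1 p'.2.2 ^ 2) ≤ 1296 * (H : ℝ) ^ 4 * (K_V / (H : ℝ) ^ 4) ^ 2 := by
    set B := 1296 * (H : ℝ) ^ 4 * (K_V / (H : ℝ) ^ 4) ^ 2 with hB
    have hB0 : 0 ≤ B := by positivity
    calc _ ≤ Real.sqrt B * Real.sqrt B :=
          mul_le_mul (Real.sqrt_le_sqrt (hsq p hpc)) (Real.sqrt_le_sqrt (hsq q hqc)) (Real.sqrt_nonneg _)
            (Real.sqrt_nonneg _)
      _ = B := Real.mul_self_sqrt hB0
  refine hmain.trans ((add_le_add hsum1 hsum2).trans (le_of_eq ?_))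
  field_simp

end Summit.QuantumFields.YangMills.Theorems.WeakCouplingRates

end
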